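import Literature.NumberTheory.EllipticCurves.X1ElevenDescentValuation
import Literature.NumberTheory.EllipticCurves.X1ElevenFiveIsogeny
import Literature.NumberTheory.NumberFields.InertiaGeneratesGalois
import Mathlib.FieldTheory.Normal.Closure
import HarnessLib

/-!
# The `5`-descent on `X₁(11)`, IV-b: the constant-kernel side — a `Γ_ℚ`-stable coset
# `R + ⟨T⟩` of `11A3(ℚ̄)` whose image `φ R ∈ 11A1(ℚ)` misses the node at `11` is rational

Global half of the explicit Eisenstein `5`-descent for `N = 11` (B. Mazur, *Modular curves and
the Eisenstein ideal*, Publ. Math. IHÉS 47 (1977), Ch. III §3; overview in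
`X1ElevenKummerValues`). For the `5`-isogeny `φ : 11A3 → 11A1` with `ker φ = ⟨T̄⟩ ≅ ℤ/5`
(`X1ElevenFiveIsogeny`), the fibre `φ⁻¹(P')` of a rational point `P' ∈ 11A1(ℚ)` is a
`Γ_ℚ`-stable coset `R + ⟨T̄⟩`; the obstruction to `P' ∈ φ(11A3(ℚ))` is the cyclic field
`F = ℚ(R)` of degree `1` or `5` cut out by the character `σ ↦ σR - R ∈ ⟨T̄⟩ ≅ ℤ/5`
(Silverman, *AEC*, X.§4: `E'(K)/φ(E(K)) ↪ H¹(G_K, E[φ]) = Hom(G_K, ℤ/5)`). This file proves: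

> **`exists_rational_of_stableCoset`**: if `R + ⟨T̄⟩` is `Γ_ℚ`-stable and the rational point
> `P' = φ R` does **not** reduce to the node `(5, 5)` of `11A1 mod 11` (`¬ ReducesToNode11 P'`),
> then `R` is the geometric point of a rational point: `P' ∈ φ(11A3(ℚ))`.

Proof. `F = ℚ(x_R, y_R) ⊂ ℚ̄` is finite and `Γ_ℚ`-stable (the translates `σR = R + S`,
`S ∈ ⟨T̄⟩` rational, have coordinates in `F`), hence Galois over `ℚ`. If `F ≠ ℚ`, its Galois
group is generated by inertia groups (tree `iSup_inertia_eq_top`, Cassels' "arithmetic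
monodromy", from Minkowski's theorem), so some `τ ≠ 1` lies in the inertia group `I(Q)` of a
maximal ideal `Q ⊆ 𝓞 F`; lifting `τ` to `σ ∈ Γ_ℚ`, `σR = R + S` with `S ∈ ⟨T̄⟩ ∖ {O}` an
*integral* affine point, and `τ` is inertial for the `Q`-adic valuation `w`
(`X1ElevenDescentValuation`). By the local engine (`X1ElevenDescentLocal`:
`integral_and_partials_lt_one_of_map_eq_add`) `R` is `w`-integral with singular reduction; as
`Δ = -11`, `Q` lies over `11`, the reduction is the node `(8,5)` (`curve11A3_node`) and
`φ R ≡ (5,5)` (`curve11A3_node_image`, Vélu's formula), i.e. `P'` reduces to the node of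
`11A1` at `11` — excluded. Hence `F = ℚ` and `R` is rational. (In Mazur's language: the Galois
module `φ⁻¹(P')` extends to a finite étale `ℤ/5`-torsor over `Spec ℤ` as soon as `P'` meets the
identity component at `11`; `Spec ℤ` is simply connected.)

## References

* [Mazur1977] B. Mazur, *Modular curves and the Eisenstein ideal*, Publ. Math. IHÉS 47 (1977),
  Ch. I §1(g) table p. 48 (`h¹(S, ℤ/p)`), Ch. III §3 Thm. (3.1), Ch. III §5 Step 3 pp. 159–160.
* [SilvermanAEC2009] J. H. Silverman, *The Arithmetic of Elliptic Curves*, 2nd ed. (2009):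
  VIII.§1 Prop. 1.5(b) and its proof, X.§4 Thm. 4.2 and its proof, Exercise 10.1.
* [Cassels1986] J. W. S. Cassels, *Local Fields* (1986), Ch. 10 Thm. 12.1.

## Design

Theorems and one predicate with body (`ReducesToNode11`); `ℚ̄ = AlgebraicClosure ℚ`;
points over `ℚ` enter through Mathlib's `Affine.Point.map` along `Algebra.ofId ℚ ℚ̄` (which is
the tree's `toGeomPoints` on points).
-/

noncomputable section

open scoped Classical NNReal
open NumberField WeierstrassCurve

namespace Literature.NumberTheory.EllipticCurves.X1Eleven

open Literature.NumberTheory.EllipticCurves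

local notation "Qbar" => AlgebraicClosure ℚ

/-- **`P' ∈ 11A1(ℚ)` reduces to the node `(5, 5)` of `11A1 mod 11`**: `P'` is an affine point
with `11`-integral coordinates `x ≡ 5`, `y ≡ 5 (mod 11)` (read on numerators and denominators).
These are the rational points off the identity component `E'₀(ℚ₁₁)` (Kodaira type `I₅`).
[cite: CremonaAlgorithms1997, Table 1, N = 11, curve A1 (reduction type I₅, c₁₁ = 5)] -/
def ReducesToNode11 (P' : curve11A1.toAffine.Point) : Prop :=
  ∃ (x y : ℚ) (h : curve11A1.toAffine.Nonsingular x y), P' = Affine.Point.some x y h ∧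
    ¬ (11 : ℤ) ∣ x.den ∧ ¬ (11 : ℤ) ∣ y.den ∧ (11 : ℤ) ∣ x.num - 5 * x.den ∧
      (11 : ℤ) ∣ y.num - 5 * y.den

/-! ### Bookkeeping: affine points of `11A3/ℚ̄` as elements of the `Γ_ℚ`-module `11A3(ℚ̄)`

`geomPoints curve11A3` is a type synonym of `(11A3/ℚ̄).Point` (tree `GaloisAction`); the identity
`gpt` fixes the synonym (so that `σ • _` finds the `Γ_ℚ`-action) and the implicit curve argument
of `Affine.Point.some` once and for all, and `toGal` views an automorphism of `ℚ̄/ℚ` as an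
element of `Γ_ℚ = Field.absoluteGaloisGroup ℚ` (a non-reducible synonym). -/

/-- An affine point of `11A3/ℚ̄` viewed in the `Γ_ℚ`-module `11A3(ℚ̄)` (the identity). [folklore] -/
abbrev gpt (P : (curve11A3.baseChange (AlgebraicClosure ℚ)).toAffine.Point) :
    geomPoints curve11A3 := P

/-- An automorphism of `ℚ̄/ℚ` as an element of `Γ_ℚ` (the identity). [folklore] -/
abbrev toGal (σ : AlgebraicClosure ℚ ≃ₐ[ℚ] AlgebraicClosure ℚ) : Field.absoluteGaloisGroup ℚ := σ

/-- Every geometric point is `O` or an affine point `(x, y)`. [folklore] -/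
theorem gpt_cases (R : geomPoints curve11A3) :
    R = 0 ∨ ∃ (x y : AlgebraicClosure ℚ)
      (h : (curve11A3.baseChange (AlgebraicClosure ℚ)).toAffine.Nonsingular x y),
        R = gpt (Affine.Point.some x y h) := by
  rcases R with _ | ⟨x, y, h⟩
  · exact Or.inl rfl
  · exact Or.inr ⟨x, y, h, rfl⟩

/-- Affine points with equal coordinates are equal. [folklore] -/
theorem gpt_congr {x y x' y' : AlgebraicClosure ℚ} (hx : x = x') (hy : y = y')
    (h : (curve11A3.baseChange (AlgebraicClosure ℚ)).toAffine.Nonsingular x y)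
    (h' : (curve11A3.baseChange (AlgebraicClosure ℚ)).toAffine.Nonsingular x' y') :
    gpt (Affine.Point.some x y h) = gpt (Affine.Point.some x' y' h') := by
  subst hx hy; rfl

/-- Equal affine points have equal coordinates. [folklore] -/
theorem gpt_some_inj {x y x' y' : AlgebraicClosure ℚ}
    {h : (curve11A3.baseChange (AlgebraicClosure ℚ)).toAffine.Nonsingular x y}
    {h' : (curve11A3.baseChange (AlgebraicClosure ℚ)).toAffine.Nonsingular x' y'}
    (e : gpt (Affine.Point.some x y h) = gpt (Affine.Point.some x' y' h')) : x = x' ∧ y = y' :=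
  ⟨(Affine.Point.some.inj e).1, (Affine.Point.some.inj e).2⟩

/-- An affine point is not `O`. [folklore] -/
theorem gpt_some_ne_zero {x y : AlgebraicClosure ℚ}
    (h : (curve11A3.baseChange (AlgebraicClosure ℚ)).toAffine.Nonsingular x y) :
    gpt (Affine.Point.some x y h) ≠ 0 :=
  Affine.Point.some_ne_zero h

/-- **The Galois action in coordinates**: `σ • (x, y) = (σ x, σ y)` on `11A3(ℚ̄)`
(Silverman, *AEC*, VIII.§1). [folklore] -/
theorem toGal_smul_gpt_some (σ : AlgebraicClosure ℚ ≃ₐ[ℚ] AlgebraicClosure ℚ)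
    {x y : AlgebraicClosure ℚ}
    (h : (curve11A3.baseChange (AlgebraicClosure ℚ)).toAffine.Nonsingular x y) :
    ∃ h', toGal σ • gpt (Affine.Point.some x y h) = gpt (Affine.Point.some (σ x) (σ y) h') :=
  ⟨_, Affine.Point.map_some (W' := curve11A3.toAffine)
    (σ : AlgebraicClosure ℚ →ₐ[ℚ] AlgebraicClosure ℚ) h⟩

/-- An element of `⟨T̄⟩ = ker φ` is `O` or an affine point `(a, b)` with `a ∈ {0, 1}`,
`b ∈ {0, -1}` (`X1ElevenFiveIsogeny.mem_ker_fiveIsogeny_imp`). [folklore] -/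
theorem eq_zero_or_eq_gpt_of_mem_zmultiples_Tbar {S : geomPoints curve11A3}
    (hS : S ∈ AddSubgroup.zmultiples Tbar) :
    S = 0 ∨ ∃ (a b : AlgebraicClosure ℚ)
      (h : (curve11A3.baseChange (AlgebraicClosure ℚ)).toAffine.Nonsingular a b),
        S = gpt (Affine.Point.some a b h) ∧ (a = 0 ∨ a = 1) ∧ (b = 0 ∨ b = -1) := by
  rw [← ker_fiveIsogeny] at hS
  rcases mem_ker_fiveIsogeny_imp hS with h0 | ⟨a, b, h, rfl, ha, hb⟩
  · exact Or.inl h0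
  · exact Or.inr ⟨a, b, h, rfl, ha, hb⟩

/-! ### Points over an intermediate field `F ⊆ ℚ̄` -/

/-- Base change of `F`-points of `11A3` to `11A3(ℚ̄)` along `F ⊆ ℚ̄`. [folklore] -/
abbrev ofF (F : IntermediateField ℚ (AlgebraicClosure ℚ)) :
    (curve11A3.baseChange F).toAffine.Point →+ geomPoints curve11A3 :=
  Affine.Point.map (W' := curve11A3.toAffine) (S := ℚ) (IntermediateField.val F)

/-- `ofF` on an affine point. [folklore] -/
theorem ofF_some (F : IntermediateField ℚ (AlgebraicClosure ℚ)) {x y : F}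
    (h : (curve11A3.baseChange F).toAffine.Nonsingular x y) :
    ∃ h', ofF F (Affine.Point.some x y h) =
      gpt (Affine.Point.some (x : AlgebraicClosure ℚ) (y : AlgebraicClosure ℚ) h') :=
  ⟨_, Affine.Point.map_some (W' := curve11A3.toAffine) (IntermediateField.val F) h⟩

/-- `ofF` is injective. [folklore] -/
theorem ofF_injective (F : IntermediateField ℚ (AlgebraicClosure ℚ)) :
    Function.Injective (ofF F) :=
  Affine.Point.map_injective (W' := curve11A3.toAffine) (f := IntermediateField.val F)

/-- An affine point of `11A3(ℚ̄)` with coordinates in `F` comes from an `F`-point. [folklore] -/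
theorem exists_ofF_eq {F : IntermediateField ℚ (AlgebraicClosure ℚ)} {x y : AlgebraicClosure ℚ}
    (h : (curve11A3.baseChange (AlgebraicClosure ℚ)).toAffine.Nonsingular x y)
    (hx : x ∈ F) (hy : y ∈ F) :
    ∃ h', ofF F (Affine.Point.some ⟨x, hx⟩ ⟨y, hy⟩ h') = gpt (Affine.Point.some x y h) := by
  have h' : (curve11A3.baseChange F).toAffine.Nonsingular ⟨x, hx⟩ ⟨y, hy⟩ :=
    (Affine.baseChange_nonsingular (W := curve11A3.toAffine) (f := IntermediateField.val F)
      (IntermediateField.val F).injective _ _).mp h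
  exact ⟨h', (ofF_some F h').choose_spec.trans rfl⟩

/-! ### The main theorem -/

/-- **A `Γ_ℚ`-stable coset `R + ⟨T̄⟩ ⊂ 11A3(ℚ̄)` over a rational point of `11A1` off the node
class at `11` is rational** (the constant-kernel side of the `5`-descent on `X₁(11)`: the torsor
`φ⁻¹(P')` is unramified everywhere — at `p ≠ 11` by good reduction and the integrality of
`⟨T⟩`, at `11` because `P'` meets the identity component — hence trivial, `ℚ` having no
unramified extensions; proof in the module docstring).
[cite: Mazur1977, Ch. III §3 Thm. (3.1) and Ch. I §1(g) (h¹(S, ℤ/p)); SilvermanAEC2009, X.§4 proof of Thm. 4.2(b); Cassels1986, Ch. 10 Thm. 12.1] -/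
theorem exists_rational_of_stableCoset {R : geomPoints curve11A3}
    (hR : ∀ σ : Field.absoluteGaloisGroup ℚ, σ • R - R ∈ AddSubgroup.zmultiples Tbar)
    {P' : curve11A1.toAffine.Point}
    (hP' : fiveIsogeny R = Affine.Point.map (W' := curve11A1.toAffine) (S := ℚ)
      (Algebra.ofId ℚ (AlgebraicClosure ℚ)) P')
    (hnode : ¬ ReducesToNode11 P') :
    ∃ Q₁ : curve11A3.toAffine.Point,
      Affine.Point.map (W' := curve11A3.toAffine) (S := ℚ)
        (Algebra.ofId ℚ (AlgebraicClosure ℚ)) Q₁ = R := by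
  -- instances on `ℚ̄`
  haveI : Algebra.IsAlgebraic ℚ Qbar := AlgebraicClosure.isAlgebraic ℚ
  haveI : Normal ℚ Qbar := @IsAlgClosure.normal ℚ Qbar _ _ (AlgebraicClosure.instAlgebra ℚ) inferInstance
  obtain rfl | ⟨xR, yR, hxy, rfl⟩ := gpt_cases R
  · exact ⟨0, rfl⟩
  -- the field `F = ℚ(x_R, y_R)`
  set F : IntermediateField ℚ Qbar := IntermediateField.adjoin ℚ ({xR, yR} : Set Qbar) with hFdef
  have hxF : xR ∈ F := IntermediateField.subset_adjoin ℚ _ (by simp)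
  have hyF : yR ∈ F := IntermediateField.subset_adjoin ℚ _ (by simp)
  haveI hfin : FiniteDimensional ℚ F :=
    IntermediateField.finiteDimensional_adjoin fun z _ => (Algebra.IsAlgebraic.isAlgebraic z).isIntegral
  -- `R` comes from an `F`-point `RF`
  obtain ⟨hRF, hψR⟩ := exists_ofF_eq hxy hxF hyF
  set RF : (curve11A3.baseChange F).toAffine.Point := Affine.Point.some _ _ hRF with hRFdef
  -- every `S ∈ ⟨T̄⟩` is `ofF F` of an `F`-point, `O` or with abscissa in `{0, 1}`
  have hSF : ∀ S ∈ AddSubgroup.zmultiples Tbar, ∃ SF : (curve11A3.baseChange F).toAffine.Point,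
      ofF F SF = S ∧ (SF = 0 ∨ ∃ (a b : F) (h : _), SF = Affine.Point.some a b h ∧ (a = 0 ∨ a = 1)) := by
    intro S hS
    rcases eq_zero_or_eq_gpt_of_mem_zmultiples_Tbar hS with rfl | ⟨a, b, h, rfl, ha, hb⟩
    · exact ⟨0, map_zero _, Or.inl rfl⟩
    · have haF : a ∈ F := by rcases ha with rfl | rfl <;> simp
      have hbF : b ∈ F := by
        rcases hb with rfl | rfl
        · simp
        · exact neg_mem (one_mem F)
      obtain ⟨hF', e⟩ := exists_ofF_eq h haF hbF
      refine ⟨Affine.Point.some _ _ hF', e, Or.inr ⟨_, _, hF', rfl, ?_⟩⟩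
      rcases ha with rfl | rfl
      · exact Or.inl rfl
      · exact Or.inr rfl
  -- `σ R = R + S` read through `ofF F`: `σ x_R, σ y_R ∈ F`, and the translation on `F`-points
  have hcoord : ∀ σ : Qbar ≃ₐ[ℚ] Qbar, ∀ SF : (curve11A3.baseChange F).toAffine.Point,
      ofF F SF = toGal σ • gpt (Affine.Point.some xR yR hxy) - gpt (Affine.Point.some xR yR hxy) →
      ∃ (u v : F) (huv : _), RF + SF = Affine.Point.some u v huv ∧
        (u : Qbar) = σ xR ∧ (v : Qbar) = σ yR := by
    intro σ SF hSψ
    obtain ⟨h', hsmul⟩ := toGal_smul_gpt_some σ hxy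
    have hsum : ofF F (RF + SF) = gpt (Affine.Point.some (σ xR) (σ yR) h') := by
      rw [map_add, hψR, hSψ, ← hsmul]; abel
    rcases hq : RF + SF with _ | ⟨u, v, huv⟩
    · rw [hq] at hsum
      exact absurd (hsum.symm.trans (map_zero (ofF F))) (gpt_some_ne_zero _)
    · rw [hq] at hsum
      obtain ⟨h'', e⟩ := ofF_some F huv
      rw [e] at hsum
      exact ⟨u, v, huv, rfl, gpt_some_inj hsum⟩
  have hstab : ∀ σ : Qbar ≃ₐ[ℚ] Qbar, σ xR ∈ F ∧ σ yR ∈ F := by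
    intro σ
    obtain ⟨SF, hSψ, -⟩ := hSF _ (hR (toGal σ))
    obtain ⟨u, v, -, -, hu, hv⟩ := hcoord σ SF hSψ
    exact ⟨hu ▸ u.2, hv ▸ v.2⟩
  -- hence `F/ℚ` is Galois, and a number field
  haveI hnormal : Normal ℚ F := by
    refine (IntermediateField.normal_iff_forall_map_le' (K := F)).mpr fun σ => ?_
    rw [hFdef, IntermediateField.adjoin_map, IntermediateField.adjoin_le_iff]
    rintro _ ⟨z, hz, rfl⟩
    simp only [Set.mem_insert_iff, Set.mem_singleton_iff] at hz
    rcases hz with rfl | rfl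
    · exact (hstab σ).1
    · exact (hstab σ).2
  haveI : IsGalois ℚ F := ⟨⟩
  haveI : NumberField F := NumberField.mk
  -- if `F = ℚ` we are done
  by_cases hF1 : Module.finrank ℚ F = 1
  · have hbot : F = ⊥ := IntermediateField.finrank_eq_one_iff.mp hF1
    have hxb : xR ∈ (⊥ : IntermediateField ℚ Qbar) := hbot ▸ hxF
    have hyb : yR ∈ (⊥ : IntermediateField ℚ Qbar) := hbot ▸ hyF
    rw [IntermediateField.mem_bot] at hxb hyb
    obtain ⟨qx, hqx⟩ := hxb
    obtain ⟨qy, hqy⟩ := hyb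
    have hxy' : (curve11A3.baseChange Qbar).toAffine.Nonsingular (algebraMap ℚ Qbar qx)
        (algebraMap ℚ Qbar qy) := by
      rw [hqx, hqy]; exact hxy
    have hq : curve11A3.toAffine.Nonsingular qx qy :=
      (Affine.map_nonsingular (W := curve11A3.toAffine) (f := algebraMap ℚ Qbar)
        (algebraMap ℚ Qbar).injective qx qy).mp hxy'
    refine ⟨Affine.Point.some qx qy hq, ?_⟩
    exact (Affine.Point.map_some (W' := curve11A3.toAffine) (Algebra.ofId ℚ Qbar) hq).trans
      (gpt_congr hqx hqy _ _)
  -- otherwise an inertia element `τ ≠ 1` at some maximal `Q`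
  exfalso
  have hGcard : Nat.card (F ≃ₐ[ℚ] F) = Module.finrank ℚ F := IsGalois.card_aut_eq_finrank ℚ F
  obtain ⟨Q, τ, hτI, hτ1⟩ : ∃ (Q : MaximalSpectrum (𝓞 F)) (τ : F ≃ₐ[ℚ] F),
      τ ∈ Q.asIdeal.inertia (F ≃ₐ[ℚ] F) ∧ τ ≠ 1 := by
    by_contra hno
    push Not at hno
    have hbot : ∀ Q : MaximalSpectrum (𝓞 F), Q.asIdeal.inertia (F ≃ₐ[ℚ] F) = ⊥ := fun Q =>
      (Subgroup.eq_bot_iff_forall _).mpr fun τ hτ => hno Q τ hτ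
    have htop := Literature.NumberTheory.NumberFields.iSup_inertia_eq_top F (F ≃ₐ[ℚ] F)
    simp only [hbot, iSup_bot] at htop
    have h1 : Nat.card (F ≃ₐ[ℚ] F) = 1 := by
      rw [← Subgroup.card_top, ← htop, Subgroup.card_bot]
    exact hF1 (hGcard ▸ h1)
  haveI : Q.asIdeal.IsMaximal := Q.isMaximal
  -- lift `τ` to `σ ∈ Gal(ℚ̄/ℚ)`
  obtain ⟨σ, hσ⟩ := AlgEquiv.restrictNormalHom_surjective (F := ℚ) (K₁ := F) Qbar τ
  have hστ : ∀ z : F, σ (z : Qbar) = ((τ z : F) : Qbar) := fun z => by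
    rw [← hσ]
    exact (AlgEquiv.restrictNormal_commutes σ F z).symm
  -- `σ R = R + S`, as an identity of `F`-points: `τ RF = RF + SF`
  obtain ⟨SF, hSψ, hSF0⟩ := hSF _ (hR (toGal σ))
  obtain ⟨u, v, huv, hq, hu, hv⟩ := hcoord σ SF hSψ
  have hrel : Affine.Point.map (τ : F →ₐ[ℚ] F) RF = RF + SF := by
    rw [hq, hRFdef, Affine.Point.map_some]
    refine some_eq_some_of_eq (Subtype.ext ?_) (Subtype.ext ?_) _ _
    · exact (hστ _).symm.trans hu.symm
    · exact (hστ _).symm.trans hv.symm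
  -- `S ≠ 0`: otherwise `σ` fixes `x_R, y_R`, hence `F`, and `τ = 1`
  rcases hSF0 with rfl | ⟨a, b, hab, rfl, ha⟩
  · apply hτ1
    have hfix : ∀ z : F, τ z = z := by
      have hσx : σ xR = xR := by
        have e := hu.symm; rw [add_zero, hRFdef] at hq
        have := (Affine.Point.some.inj hq).1
        rw [← this] at e; exact e.symm ▸ rfl
      have hσy : σ yR = yR := by
        have e := hv.symm; rw [add_zero, hRFdef] at hq
        have := (Affine.Point.some.inj hq).2
        rw [← this] at e; exact e.symm ▸ rfl
      -- `F ≤ fixedField ⟨σ⟩`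
      have hmemfix : ∀ z : Qbar, σ z = z →
          z ∈ IntermediateField.fixedField (Subgroup.zpowers σ) := by
        intro z hz
        rw [IntermediateField.mem_fixedField_iff]
        rintro g ⟨k, rfl⟩
        have hinv : σ⁻¹ z = z := by
          rw [AlgEquiv.aut_inv]
          conv_lhs => rw [← hz]
          exact σ.symm_apply_apply z
        suffices h : ∀ k : ℤ, (σ ^ k) z = z from h k
        intro k
        induction k using Int.induction_on with
        | zero => simp
        | succ n ih => rw [zpow_add_one, AlgEquiv.mul_apply, hz]; exact ih
        | pred n ih => rw [zpow_sub_one, AlgEquiv.mul_apply, hinv]; exact ih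
      have hle : F ≤ IntermediateField.fixedField (Subgroup.zpowers σ) := by
        rw [hFdef, IntermediateField.adjoin_le_iff]
        rintro z hz
        simp only [Set.mem_insert_iff, Set.mem_singleton_iff] at hz
        rcases hz with rfl | rfl
        · exact hmemfix _ hσx
        · exact hmemfix _ hσy
      intro z
      have hz := hle z.2
      rw [IntermediateField.mem_fixedField_iff] at hz
      have h1 : σ (z : Qbar) = z := hz σ (Subgroup.mem_zpowers σ)
      rw [hστ z] at h1
      exact Subtype.ext h1
    exact AlgEquiv.ext hfix
  -- the `Q`-adic valuation and the local engine
  set w : Valuation F ℝ≥0 := adicValNNReal Q.asIdeal with hwdef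
  haveI : (curve11A3.baseChange F).IsIntegral w.integer := isIntegral_curve11A3 (w := w)
  have hτQ := smul_mem_iff_of_mem_inertia Q.asIdeal hτI
  have hσw : ∀ z, w (τ z) = w z := fun z => adicValNNReal_smul_eq Q.asIdeal τ hτQ z
  have hσI : ∀ z, w z ≤ 1 → w (τ z - z) < 1 := fun z hz =>
    adicValNNReal_smul_sub_lt_one Q.asIdeal hτI hz
  have has : w a ≤ 1 := by
    rcases ha with rfl | rfl <;> simp
  -- (`convert`: the decidability instances hidden in `+` on `F`-points are subsingletons)
  obtain ⟨hxint, hX, hY⟩ :=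
    integral_and_partials_lt_one_of_map_eq_add (w := w) curve11A3 τ hσw hσI hRF hab has
      (by convert hrel using 3 <;> first | rfl | (congr 1; exact Subsingleton.elim _ _))
  -- `Q` lies over `11`: `w 11 < 1`
  have h11 : w (11 : F) < 1 := by
    by_contra hge
    have h11' : w (11 : F) = 1 := le_antisymm (val_natCast_le_one w 11) (not_lt.mp hge)
    have hΔ : w (curve11A3.baseChange F).Δ = 1 := by
      rw [WeierstrassCurve.baseChange, map_Δ, curve11A3_Δ, map_neg, Valuation.map_neg]
      simpa using h11'
    exact not_val_partial_lt_one hΔ hRF.1 hxint ⟨hX, hY⟩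
  -- coordinates in `F`
  set xF : F := ⟨xR, hxF⟩ with hxFdef
  set yF : F := ⟨yR, hyF⟩ with hyFdef
  have he : yF ^ 2 + yF = xF ^ 3 - xF ^ 2 := by
    have := (Affine.equation_iff _ _).mp hRF.1
    simp only [WeierstrassCurve.baseChange, map_a₁, map_a₂, map_a₃, map_a₄, map_a₆, curve11A3_a₁,
      curve11A3_a₂, curve11A3_a₃, curve11A3_a₄, curve11A3_a₆, map_zero, map_one, map_neg] at this
    linear_combination this
  have hyint : w yF ≤ 1 := val_y_le_one hRF.1 hxint
  have hX' : w (3 * xF ^ 2 - 2 * xF) < 1 := by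
    have e : (curve11A3.baseChange F).toAffine.polynomialX.evalEval xF yF =
        -(3 * xF ^ 2 - 2 * xF) := by
      rw [Affine.evalEval_polynomialX]
      simp only [WeierstrassCurve.baseChange, map_a₁, map_a₂, map_a₄, curve11A3_a₁, curve11A3_a₂,
        curve11A3_a₄, map_zero, map_neg, map_one]
      ring
    rw [e, Valuation.map_neg] at hX
    exact hX
  have hY' : w (2 * yF + 1) < 1 := by
    have e : (curve11A3.baseChange F).toAffine.polynomialY.evalEval xF yF = 2 * yF + 1 := by
      rw [Affine.evalEval_polynomialY]
      simp only [WeierstrassCurve.baseChange, map_a₁, map_a₃, curve11A3_a₁, curve11A3_a₃,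
        map_zero, map_one]
      ring
    rw [e] at hY
    exact hY
  obtain ⟨hx8, hy5⟩ := curve11A3_node w h11 he hxint hyint hX' hY'
  obtain ⟨hh1, hvx, hvy⟩ := curve11A3_node_image w h11 hxint hx8 hy5
  -- `φ R` in coordinates
  have hhK : xR ^ 2 - xR ≠ 0 := by
    intro h0
    have : xF ^ 2 - xF = 0 := by
      apply (IntermediateField.val F).injective
      rw [map_sub, map_pow, map_zero]
      exact h0
    rw [this, map_zero] at hh1
    exact zero_ne_one hh1
  obtain ⟨hφ', hφ⟩ := fiveIsogeny_some hxy hhK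
  have hφg : fiveIsogeny (gpt (Affine.Point.some xR yR hxy)) = _ := hφ
  rw [hφg] at hP'
  rcases P' with _ | ⟨x', y', hns'⟩
  · exact absurd hP' (Affine.Point.some_ne_zero _)
  have hP'' := hP'.trans (Affine.Point.map_some (W' := curve11A1.toAffine) (Algebra.ofId ℚ Qbar) hns')
  obtain ⟨hx', hy'⟩ := Affine.Point.some.inj hP''
  rw [geom_valX] at hx'
  rw [geom_valY] at hy'
  -- the formula in `F` maps to the formula in `Qbar`
  set uF : F := (xF ^ 5 - 2 * xF ^ 4 + 3 * xF ^ 3 - 2 * xF + 1) / (xF ^ 2 - xF) ^ 2 with huF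
  set vF : F := ((xF ^ 6 - 3 * xF ^ 5 + xF ^ 4 - 3 * xF ^ 3 + 6 * xF ^ 2 - 6 * xF + 2) * yF +
      (-xF ^ 4 - xF ^ 3 + 3 * xF ^ 2 - 3 * xF + 1)) / (xF ^ 2 - xF) ^ 3 with hvF
  have huK : IntermediateField.val F uF = algebraMap ℚ Qbar x' := by
    rw [← show (Algebra.ofId ℚ Qbar) x' = algebraMap ℚ Qbar x' from rfl, ← hx', huF]
    simp only [map_div₀, map_pow, map_sub, map_add, map_mul, map_one, map_ofNat]
    rfl
  have hvK : IntermediateField.val F vF = algebraMap ℚ Qbar y' := by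
    rw [← show (Algebra.ofId ℚ Qbar) y' = algebraMap ℚ Qbar y' from rfl, ← hy', hvF]
    simp only [map_div₀, map_pow, map_sub, map_add, map_mul, map_one, map_neg, map_ofNat]
    rfl
  have hux : uF = ((x' : ℚ) : F) := by
    apply (IntermediateField.val F).injective
    show IntermediateField.val F uF = IntermediateField.val F (x' : F)
    rw [huK]
    rfl
  have hvy' : vF = ((y' : ℚ) : F) := by
    apply (IntermediateField.val F).injective
    show IntermediateField.val F vF = IntermediateField.val F (y' : F)
    rw [hvK]
    rfl
  rw [hux] at hvx
  rw [hvy'] at hvy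
  have hle_of_lt : ∀ {z : F}, w (z - 5) < 1 → w z ≤ 1 := fun {z} hz => by
    rw [show z = (z - 5) + 5 by ring]
    exact (Valuation.map_add w _ _).trans (max_le hz.le (val_natCast_le_one w 5))
  have h11p : Nat.Prime 11 := by decide
  obtain ⟨hxd, hxn⟩ := not_dvd_den_and_dvd_of_val w h11p h11 x' 5 (hle_of_lt hvx)
    (by exact_mod_cast hvx)
  obtain ⟨hyd, hyn⟩ := not_dvd_den_and_dvd_of_val w h11p h11 y' 5 (hle_of_lt hvy)
    (by exact_mod_cast hvy)
  exact hnode ⟨x', y', hns', rfl, hxd, hyd, hxn, hyn⟩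

end Literature.NumberTheory.EllipticCurves.X1Eleven

end
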